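import Literature.NumberTheory.LFunctions.NoRealZeroCertificateReplaySplit
import HarnessLib

/-!
# Kernel replay of the Lu–Zaman–Zhao certificates: assembling `HeavyRows` from row-list certificates

Topic `Literature/NumberTheory/LFunctions`. Bookkeeping for the HEAVY layer of the replay (item
`HeavyRows := ∀ D ∈ heavyList15, direct D = false → CertifiedAt (1/5) D` of route `LZZCertificateReplay`,
split W-3): the heavy files prove `∀ D ∈ rowsDK rowsᵢ, CertifiedAt (1/5) D` for many row lists (one per
tier file); `HeavyRows` follows chunk by chunk once every non-direct member of a chunk `heavyChunk<k>` is
found in the union of the relevant row lists — a finite check `coveredBy`, evaluated by the kernel.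

* `coveredBy L R` — every `D ∈ L` is directly settled (`direct D`) or occurs in `R`;
* `heavy_of_coveredBy` — from `∀ D ∈ R, CertifiedAt c D` and `coveredBy L R = true` conclude
  `∀ D ∈ L, direct D = false → CertifiedAt c D`;
* `certifiedAt_forall_append`, `heavy_forall_append` — joining facts over concatenated lists (the shape of
  `heavyList15 = heavyChunk1 ++ (heavyChunk2 ++ …)`).

Definitions and theorems only; nothing is evaluated here.

## References

* W. Lu, A. Zaman, K. Zhao, *Dirichlet L-functions of quadratic characters have no exceptional
  zeros for moduli up to 10¹⁰*, Math. Comp. (2026), arXiv:2602.03626, §2.1–§3. [LuZamanZhao2026]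
-/

namespace Literature.NumberTheory.LFunctions
namespace LuZamanZhao2026
namespace Replay

/-- **Coverage check**: every `D ∈ L` is directly settled or listed in `R`. [cite: LuZamanZhao2026, §3] -/
def coveredBy (L R : List ℤ) : Bool :=
  L.all fun D => direct D || R.elem D

/-- **From coverage to the heavy-layer statement for `L`.** [cite: LuZamanZhao2026, §2.1–§3] -/
theorem heavy_of_coveredBy {c : ℝ} {L R : List ℤ} (hR : ∀ D ∈ R, CertifiedAt c D)
    (h : coveredBy L R = true) : ∀ D ∈ L, direct D = false → CertifiedAt c D := by
  intro D hD hdir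
  have h' := List.all_eq_true.1 h D hD
  rw [hdir, Bool.false_or] at h'
  exact hR D (List.mem_of_elem_eq_true h')

/-- Joining row-list certificates over a concatenation. [cite: LuZamanZhao2026, §2.1–§3] -/
theorem certifiedAt_forall_append {c : ℝ} {R₁ R₂ : List ℤ} (h₁ : ∀ D ∈ R₁, CertifiedAt c D)
    (h₂ : ∀ D ∈ R₂, CertifiedAt c D) : ∀ D ∈ R₁ ++ R₂, CertifiedAt c D := by
  intro D hD
  rcases List.mem_append.1 hD with h | h
  · exact h₁ D h
  · exact h₂ D h

/-- Joining heavy-layer statements over a concatenation (chunk by chunk to `heavyList15`).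
[cite: LuZamanZhao2026, §2.1–§3] -/
theorem heavy_forall_append {c : ℝ} {L₁ L₂ : List ℤ}
    (h₁ : ∀ D ∈ L₁, direct D = false → CertifiedAt c D)
    (h₂ : ∀ D ∈ L₂, direct D = false → CertifiedAt c D) :
    ∀ D ∈ L₁ ++ L₂, direct D = false → CertifiedAt c D := by
  intro D hD
  rcases List.mem_append.1 hD with h | h
  · exact h₁ D h
  · exact h₂ D h

/-- A chunk all of whose members are directly settled contributes nothing. [cite: LuZamanZhao2026, §3] -/
theorem heavy_of_all_direct {c : ℝ} {L : List ℤ} (h : (L.all fun D => direct D) = true) :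
    ∀ D ∈ L, direct D = false → CertifiedAt c D := by
  intro D hD hdir
  have := List.all_eq_true.1 h D hD
  rw [hdir] at this
  exact absurd this Bool.false_ne_true

end Replay
end LuZamanZhao2026
end Literature.NumberTheory.LFunctions
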